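import Mathlib
import Summits.ValiantsHypothesis.ValiantsHypothesis.Theorems.NewtonUnitEquationsDissociatedUniformTotalsLawLeftTurning
import Summits.ValiantsHypothesis.ValiantsHypothesis.Theorems.NewtonUnitEquationsDissociatedUniformTotalsLawUnimodalGraphs
import HarnessLib

/-!
# Crux `NewtonUnitEquations.DissociatedUniform` (stmt-ValiantsHypothesis-5905): the uniform union bound COVERS THE CENSUS FAMILIES by name

Companion of `…TotalsLawLeftTurning` (`unionVert_le_twelve_mul`: `#vert conv U_s(Z) ≤ 12q` for convexly ordered, injective, co-oriented
strictly convex pairs) and `…TotalsLawUnimodalGraphs` (`convexlyOrdered_parabola`).  The (Q**) census families of memo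
`Cruxes/DissociatedUniform/NOTES-d1g3.md` §3 / `NOTES-t1g4.md` §5 are PARABOLA PAIRS `a k = (P k, Q k²)`, `b k = (P' k, Q' k²)` with natural
labels; here:
* `LeftTurning.affine` / `LeftTurning.affine_neg`: affine images with `det M > 0` (`< 0`) of left-turning curves are left- (right-)turning;
* `parabola_det`, `leftTurning_parabola` / `rightTurning_parabola`: for `q ≥ 3` the census parabola turns left at every label when `PQ > 0`
  and right when `PQ < 0` (determinant `PQ·2` inside, `PQ·(q−1)(q−2)` at the two wrap-around labels); `injective_parabola`;
* **`unionVert_parabolaPair_le`** / **`unionTotal_parabolaPair_le_uniform`**: for `PQ`, `P'Q'` of the same sign and EVERY position set,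
  `#vert conv U_s(Z) ≤ 12q` and `unionTotal ≤ 12q²` — compare `unionTotal_parabolaPair_le` of `…UnimodalGraphs` (constant `2 + #bdry Z`,
  linear in the number of runs of `Z`).
Honest label: corollaries on the census stratum; `ConvexUnionVertBound C` (`C ≥ 3`), `UnionTotalsLaw`, `TotalsLawThree` remain OPEN; nothing
here bears on VP ≠ VNP.
[folklore]
-/

set_option linter.dupNamespace false -- `ValiantsHypothesis.ValiantsHypothesis` (summit = problem) in every name

open scoped BigOperators Pointwise

namespace Summit.ValiantsHypothesis.ValiantsHypothesis.Theorems.NewtonUnitEquationsDissociatedUniform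

namespace TotalsLaw

open Literature.Computability.AlgebraicComplexity.KPTT.PlanarMinkowski

section CensusPairs

variable {q : ℕ} [NeZero q]

omit [NeZero q] in
/-- **Orientation-preserving affine images of left-turning curves are left-turning** (`det(MΔ, MΔ') = det M · det(Δ, Δ')`).
[folklore] -/
theorem LeftTurning.affine {a : ZMod q → (Fin 2 → ℝ)} (ha : LeftTurning a) (M : Matrix (Fin 2) (Fin 2) ℝ) (hM : 0 < M.det)
    (v : Fin 2 → ℝ) : LeftTurning fun x => M.mulVec (a x) + v := by
  intro z
  have key : ((M.mulVec (a (z + 1)) + v) 0 - (M.mulVec (a z) + v) 0) * ((M.mulVec (a (z + 2)) + v) 1 - (M.mulVec (a (z + 1)) + v) 1) -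
      ((M.mulVec (a (z + 1)) + v) 1 - (M.mulVec (a z) + v) 1) * ((M.mulVec (a (z + 2)) + v) 0 - (M.mulVec (a (z + 1)) + v) 0) =
      M.det * ((a (z + 1) 0 - a z 0) * (a (z + 2) 1 - a (z + 1) 1) - (a (z + 1) 1 - a z 1) * (a (z + 2) 0 - a (z + 1) 0)) := by
    simp only [Matrix.mulVec, dotProduct, Fin.sum_univ_two, Pi.add_apply, Matrix.det_fin_two]
    ring
  rw [key]
  exact mul_pos hM (ha z)

omit [NeZero q] in
/-- Orientation-REVERSING affine images of left-turning curves are right-turning. [folklore] -/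
theorem LeftTurning.affine_neg {a : ZMod q → (Fin 2 → ℝ)} (ha : LeftTurning a) (M : Matrix (Fin 2) (Fin 2) ℝ) (hM : M.det < 0)
    (v : Fin 2 → ℝ) : RightTurning fun x => M.mulVec (a x) + v := by
  intro z
  have key : ((M.mulVec (a (z + 1)) + v) 0 - (M.mulVec (a z) + v) 0) * ((M.mulVec (a (z + 2)) + v) 1 - (M.mulVec (a (z + 1)) + v) 1) -
      ((M.mulVec (a (z + 1)) + v) 1 - (M.mulVec (a z) + v) 1) * ((M.mulVec (a (z + 2)) + v) 0 - (M.mulVec (a (z + 1)) + v) 0) =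
      M.det * ((a (z + 1) 0 - a z 0) * (a (z + 2) 1 - a (z + 1) 1) - (a (z + 1) 1 - a z 1) * (a (z + 2) 0 - a (z + 1) 0)) := by
    simp only [Matrix.mulVec, dotProduct, Fin.sum_univ_two, Pi.add_apply, Matrix.det_fin_two]
    ring
  rw [key]
  exact mul_neg_of_neg_of_pos hM (ha z)

/-- The turning determinant of the census parabola `k ↦ (P k, Q k²)` at every label is `P·Q` times a POSITIVE number (`q ≥ 3`;
`2` in the interior, `(q-1)(q-2)` at the two wrap-around labels). [folklore] -/
theorem parabola_det (hq : 3 ≤ q) (P Q : ℝ) (z : ZMod q) : ∃ N : ℝ, 0 < N ∧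
    ((fun z : ZMod q => ![P * (z.val : ℝ), Q * (z.val : ℝ) ^ 2]) (z + 1) 0 - (fun z : ZMod q => ![P * (z.val : ℝ), Q * (z.val : ℝ) ^ 2]) z 0) *
      ((fun z : ZMod q => ![P * (z.val : ℝ), Q * (z.val : ℝ) ^ 2]) (z + 2) 1 - (fun z : ZMod q => ![P * (z.val : ℝ), Q * (z.val : ℝ) ^ 2]) (z + 1) 1) -
    ((fun z : ZMod q => ![P * (z.val : ℝ), Q * (z.val : ℝ) ^ 2]) (z + 1) 1 - (fun z : ZMod q => ![P * (z.val : ℝ), Q * (z.val : ℝ) ^ 2]) z 1) *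
      ((fun z : ZMod q => ![P * (z.val : ℝ), Q * (z.val : ℝ) ^ 2]) (z + 2) 0 - (fun z : ZMod q => ![P * (z.val : ℝ), Q * (z.val : ℝ) ^ 2]) (z + 1) 0)
    = P * Q * N := by
  set k := z.val with hk
  have hkq : k < q := ZMod.val_lt z
  have hz : z = (k : ZMod q) := (ZMod.natCast_zmod_val z).symm
  have h1 : (z + 1).val = (k + 1) % q := by
    rw [hz, show (k : ZMod q) + 1 = ((k + 1 : ℕ) : ZMod q) by push_cast; ring, ZMod.val_natCast]
  have h2 : (z + 2).val = (k + 2) % q := by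
    rw [hz, show (k : ZMod q) + 2 = ((k + 2 : ℕ) : ZMod q) by push_cast; ring, ZMod.val_natCast]
  simp only [Matrix.cons_val_zero, Matrix.cons_val_one]
  rw [h1, h2]
  -- the three cases of the wrap-around
  rcases Nat.lt_or_ge (k + 2) q with hlt | hge
  · refine ⟨2, by norm_num, ?_⟩
    rw [Nat.mod_eq_of_lt hlt, Nat.mod_eq_of_lt (by omega : k + 1 < q)]
    push_cast; ring
  · rcases Nat.lt_or_ge (k + 1) q with hlt1 | hge1
    · -- `k = q - 2`: values `k, k+1, 0`
      have hk2 : k + 2 = q := by omega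
      have hk1r : (1 : ℝ) ≤ k := by exact_mod_cast (show 1 ≤ k by omega)
      refine ⟨(k : ℝ) * (k + 1), by positivity, ?_⟩
      rw [Nat.mod_eq_of_lt hlt1, hk2, Nat.mod_self]
      push_cast; ring
    · -- `k = q - 1`: values `k, 0, 1`
      have hk1 : k + 1 = q := by omega
      have hm2 : (k + 2) % q = 1 := by
        rw [show k + 2 = q + 1 by omega, Nat.add_mod_left, Nat.mod_eq_of_lt (by omega : 1 < q)]
      have hk2r : (2 : ℝ) ≤ k := by exact_mod_cast (show 2 ≤ k by omega)
      refine ⟨(k : ℝ) * (k - 1), by nlinarith, ?_⟩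
      rw [hk1, Nat.mod_self, hm2]
      push_cast; ring

/-- **The census parabolas are left-turning** for `P·Q > 0` (`q ≥ 3`). [folklore] -/
theorem leftTurning_parabola (hq : 3 ≤ q) {P Q : ℝ} (hPQ : 0 < P * Q) :
    LeftTurning (fun z : ZMod q => ![P * (z.val : ℝ), Q * (z.val : ℝ) ^ 2]) := by
  intro z
  obtain ⟨N, hN, hdet⟩ := parabola_det hq P Q z
  rw [hdet]
  exact mul_pos hPQ hN

/-- … and right-turning for `P·Q < 0`. [folklore] -/
theorem rightTurning_parabola (hq : 3 ≤ q) {P Q : ℝ} (hPQ : P * Q < 0) :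
    RightTurning (fun z : ZMod q => ![P * (z.val : ℝ), Q * (z.val : ℝ) ^ 2]) := by
  intro z
  obtain ⟨N, hN, hdet⟩ := parabola_det hq P Q z
  rw [hdet]
  exact mul_neg_of_neg_of_pos hPQ hN

/-- The census parabola is injective on the labels (`P ≠ 0`). [folklore] -/
theorem injective_parabola {P : ℝ} (hP : P ≠ 0) (Q : ℝ) :
    Function.Injective (fun z : ZMod q => ![P * (z.val : ℝ), Q * (z.val : ℝ) ^ 2]) := by
  intro z z' h
  have h0 := congrFun h 0
  simp only [Matrix.cons_val_zero] at h0
  have hv : (z.val : ℝ) = z'.val := mul_left_cancel₀ hP h0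
  exact ZMod.val_injective q (by exact_mod_cast hv)

/-- **The uniform union bound for the census parabola pairs**: for `a k = (P k, Q k²)`, `b k = (P' k, Q' k²)` with natural labels
(`q ≥ 3`) and `P·Q`, `P'·Q'` of the SAME sign, EVERY fibre union has `#vert conv U_s(Z) ≤ 12·q` and `unionTotal a b Z ≤ 12·q²`
(the census families of memo NOTES-d1g3 §3 / NOTES-t1g4 §5 are covered by name). [folklore] -/
theorem unionVert_parabolaPair_le (hq : 3 ≤ q) {P Q P' Q' : ℝ} (hsign : (0 < P * Q ∧ 0 < P' * Q') ∨ (P * Q < 0 ∧ P' * Q' < 0))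
    (Z : Finset (ZMod q)) (s : ZMod q) :
    unionVert (fun z : ZMod q => ![P * (z.val : ℝ), Q * (z.val : ℝ) ^ 2])
        (fun z : ZMod q => ![P' * (z.val : ℝ), Q' * (z.val : ℝ) ^ 2]) (Z : Set (ZMod q)) s ≤ 12 * q := by
  have hP : P ≠ 0 := by rcases hsign with ⟨h, -⟩ | ⟨h, -⟩ <;> exact fun h0 => by rw [h0, zero_mul] at h; exact lt_irrefl _ h
  have hP' : P' ≠ 0 := by rcases hsign with ⟨-, h⟩ | ⟨-, h⟩ <;> exact fun h0 => by rw [h0, zero_mul] at h; exact lt_irrefl _ h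
  refine unionVert_le_twelve_mul _ _ (convexlyOrdered_parabola P Q) (convexlyOrdered_parabola P' Q') (injective_parabola hP Q)
    (injective_parabola hP' Q') ?_ Z s
  rcases hsign with ⟨h, h'⟩ | ⟨h, h'⟩
  · exact Or.inl ⟨leftTurning_parabola hq h, leftTurning_parabola hq h'⟩
  · exact Or.inr ⟨rightTurning_parabola hq h, rightTurning_parabola hq h'⟩

/-- … and the union totals law `unionTotal a b Z ≤ 12·q²` for such parabola pairs and every position set. [folklore] -/
theorem unionTotal_parabolaPair_le_uniform (hq : 3 ≤ q) {P Q P' Q' : ℝ}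
    (hsign : (0 < P * Q ∧ 0 < P' * Q') ∨ (P * Q < 0 ∧ P' * Q' < 0)) (Z : Finset (ZMod q)) :
    unionTotal (fun z : ZMod q => ![P * (z.val : ℝ), Q * (z.val : ℝ) ^ 2])
        (fun z : ZMod q => ![P' * (z.val : ℝ), Q' * (z.val : ℝ) ^ 2]) (Z : Set (ZMod q)) ≤ 12 * q ^ 2 := by
  unfold unionTotal
  calc ∑ s, unionVert (fun z : ZMod q => ![P * (z.val : ℝ), Q * (z.val : ℝ) ^ 2])
          (fun z : ZMod q => ![P' * (z.val : ℝ), Q' * (z.val : ℝ) ^ 2]) (Z : Set (ZMod q)) s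
      ≤ ∑ _s : ZMod q, 12 * q := Finset.sum_le_sum fun s _ => unionVert_parabolaPair_le hq hsign Z s
    _ = 12 * q ^ 2 := by rw [Finset.sum_const, Finset.card_univ, ZMod.card, smul_eq_mul]; ring

end CensusPairs

end TotalsLaw

end Summit.ValiantsHypothesis.ValiantsHypothesis.Theorems.NewtonUnitEquationsDissociatedUniform
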